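import Literature.Probability.Percolation.ArmSeparationHalfStepFour
import HarnessLib

/-!
# Untwisting the half-turned landing: from `sepFourArmG r N 3` to `sepFourArmQ (8 (r/64)) N`

Topic `Literature/Probability/Percolation`; family `crit-perc` / near-critical percolation on `𝕋`.
A brick of the near-critical arm-separation theorem for four arms of alternating colours
(P. Nolin, *Near-critical percolation in two dimensions*, EJP 13 (2008), Thm. 11 for `j = 4`,
`σ = BWBW` [arXiv 0711.4948: Thm. 10]; §4.2 "the landing areas can be prescribed arbitrarily —
relocation of the landing sequences", §4.3 Prop. 12 (i), Lemma 13; §4.4 p. 13). The inner landing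
scheme (`ArmSeparationInSchemeFour`) lands the four inner extremities either on the sides of the outer
ones (`q = 0`) or on the opposite sides (`q = 3`, a half turn). Here the half-turned configuration is
untwisted at constant cost: all four INNER extremities are moved simultaneously by a half turn
anticlockwise (a lockstep relocation, radially nested like a four-start thread) from `∂Λ_r` to
`∂Λ_{r'}`, `r' = 8 ⌊r/64⌋`, along U-shaped corridors made of boxes of bounded aspect ratio: this file
gives the corridors of the open arm (`uTurnA`, side `0` to side `3` through the top) and of the closed
arm (`uTurnB`, side `2` to side `5` through the left, in the coordinates of the colour-exchanged
configuration) and the deterministic gluings (`uTurnA_glue`, `uTurnB_glue`); locality, probabilities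
and Nolin's Lemma 13 follow in `ArmSeparationUntwistBoundFour`. Everything here is proved; no named
facts are introduced.

## References

* P. Nolin, Near-critical percolation in two dimensions, *Electron. J. Probab.* 13 (2008), §4.2–4.4
  (arXiv 0711.4948: Def. 6–8, Prop. 11, Lemma 12, proof of Thm. 10) [Nolin2008].
* H. Kesten, Scaling relations for 2D-percolation, *Comm. Math. Phys.* 109 (1987), Lemma 2 [Kesten1987].
-/

noncomputable section

open MeasureTheory Set

namespace Literature.Probability.Percolation

open LatticeModels

/-! ### Sector helpers for the shell -/

/-- Membership in `shellBall` from coordinates in the sector of the right side `{x₁ ≤ 0 ≤ x₀ + x₁}`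
(norm `x₀`). [folklore] -/
theorem mem_shell_of_rightSector {lo hi : ℤ} {c : Site 2} {r : ℕ} {v : Site 2} (h1 : lo ≤ v 0) (h2 : v 0 ≤ hi)
    (h3 : v 1 ≤ 0) (h4 : 0 ≤ v 0 + v 1) : v ∈ shellBall lo hi c r :=
  Or.inl ⟨le_triNorm_iff_lin.2 (Or.inl h1), triNorm_le_iff_lin.2 (by omega)⟩

/-- Membership in `shellBall` from coordinates in the sector of the upper-left side
`{x₀ + x₁ ≤ 0 ≤ x₁}` (norm `-x₀`). [folklore] -/
theorem mem_shell_of_leftUpper {lo hi : ℤ} {c : Site 2} {r : ℕ} {v : Site 2} (h1 : lo ≤ -v 0) (h2 : -v 0 ≤ hi)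
    (h3 : 0 ≤ v 1) (h4 : v 0 + v 1 ≤ 0) : v ∈ shellBall lo hi c r :=
  Or.inl ⟨le_triNorm_iff_lin.2 (Or.inr (Or.inl h1)), triNorm_le_iff_lin.2 (by omega)⟩

/-- Membership in `shellBall` from coordinates in the third quadrant `{x₀ ≤ 0, x₁ ≤ 0}`
(norm `-(x₀ + x₁)`). [folklore] -/
theorem mem_shell_of_lowerLeft {lo hi : ℤ} {c : Site 2} {r : ℕ} {v : Site 2} (h1 : lo ≤ -(v 0 + v 1))
    (h2 : -(v 0 + v 1) ≤ hi) (h3 : v 0 ≤ 0) (h4 : v 1 ≤ 0) : v ∈ shellBall lo hi c r :=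
  Or.inl ⟨le_triNorm_iff_lin.2 (Or.inr (Or.inr (Or.inr (Or.inr (Or.inr h1))))), triNorm_le_iff_lin.2 (by omega)⟩

/-- Membership in `shellBall` from coordinates in the sector of the bottom side `{0 ≤ x₀, x₀ + x₁ ≤ 0}`
(norm `-x₁`). [folklore] -/
theorem mem_shell_of_bottom {lo hi : ℤ} {c : Site 2} {r : ℕ} {v : Site 2} (h1 : lo ≤ -v 1) (h2 : -v 1 ≤ hi)
    (h3 : 0 ≤ v 0) (h4 : v 0 + v 1 ≤ 0) : v ∈ shellBall lo hi c r :=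
  Or.inl ⟨le_triNorm_iff_lin.2 (Or.inr (Or.inr (Or.inr (Or.inl h1)))), triNorm_le_iff_lin.2 (by omega)⟩

/-! ### The U-turn corridor of the open arm (side `0` of `Λ_r` to side `3` of `Λ_{r'}`) -/

/-- The `i`-th comb strip of the open U-turn: the horizontal strip of rows `[g_i, g_i + h]` over the
free space of the right side, crossed horizontally. [cite: Nolin2008, §4.3 Prop. 12 (proof) (arXiv 0711.4948: Prop. 11)] -/
def uCombA (r i : ℕ) : Set (SiteConfig (Site 2)) :=
  triHCross ((r : ℤ) - (r / 8 : ℕ) - (r / 16 : ℕ) - 2) (-(sepGlueHeight r : ℤ) + i * ((r / 64 / 2 : ℕ) : ℤ)) (r / 8 + r / 16 + 1) (r / 64 / 2)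

/-- The nine single boxes of the open U-turn between the comb and the target free space, indexed by
`0, …, 8`: the highway up the right side, then alternately leftward and upward boxes through the
sector of the side `1`, leftward and downward through the sector of the side `2`, down the outside of
the side `3` of `Λ_{r'}` and the horizontal connector into its free space (`e = ⌊r/64⌋`, `r' = 8e`,
`t = ⌊r'/64⌋`). [cite: Nolin2008, §4.2 (relocation of landing sequences) (arXiv 0711.4948: Def. 8, Fig. 6)] -/
def uBoxA (r : ℕ) : ℕ → Set (SiteConfig (Site 2))
  | 0 => triVCross ((r : ℤ) - (r / 8 : ℕ) - (r / 16 : ℕ) - 2) (-(sepGlueHeight r : ℤ)) (r / 16) (sepGlueHeight r + 4 * (r / 64))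
  | 1 => triHCross (30 * (r / 64 : ℕ)) (2 * (r / 64 : ℕ)) (r - r / 8 - 2 - 30 * (r / 64)) (2 * (r / 64))
  | 2 => triVCross (30 * (r / 64 : ℕ)) (2 * (r / 64 : ℕ)) (2 * (r / 64)) (12 * (r / 64))
  | 3 => triHCross (10 * (r / 64 : ℕ)) (12 * (r / 64 : ℕ)) (22 * (r / 64)) (2 * (r / 64))
  | 4 => triVCross (10 * (r / 64 : ℕ)) (12 * (r / 64 : ℕ)) (2 * (r / 64)) (14 * (r / 64))
  | 5 => triHCross (-(6 * (r / 64 : ℕ) : ℤ)) (24 * (r / 64 : ℕ)) (18 * (r / 64)) (2 * (r / 64))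
  | 6 => triVCross (-(6 * (r / 64 : ℕ) : ℤ)) (13 * (r / 64 : ℕ)) (2 * (r / 64)) (13 * (r / 64))
  | 7 => triHCross (-(13 * (r / 64 : ℕ) : ℤ)) (13 * (r / 64 : ℕ)) (9 * (r / 64)) (2 * (r / 64))
  | 8 => triVCross (-(13 * (r / 64 : ℕ) : ℤ)) (3 * (r / 64 : ℕ)) (2 * (r / 64)) (12 * (r / 64))
  | 9 => triHCross (-(13 * (r / 64 : ℕ) : ℤ)) (4 * (r / 64 : ℕ) - (8 * (r / 64) / 64 : ℕ)) (6 * (r / 64) - 1) (8 * (r / 64) / 64)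
  | _ => Set.univ

/-- The thinned new free space of the open U-turn: the free space of the right side of `Λ_{r'}` of
`sepInCorrQ`, read through the half turn `rotConfig 3` (so it lies at the left side). [cite: Nolin2008, §4.2 Def. 6–7 (arXiv 0711.4948: Def. 6–7)] -/
def uFenceA (r : ℕ) : Set (SiteConfig (Site 2)) :=
  {χ | rotConfig 3 χ ∈ triVCross ((8 * (r / 64) : ℕ) - (8 * (r / 64) / 8 : ℕ) + 1)
    (-((8 * (r / 64) / 2 : ℕ) : ℤ) - (8 * (r / 64) / 64 : ℕ)) (8 * (r / 64) / 8 - 2) (2 * (8 * (r / 64) / 64))}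

/-- **The U-turn corridor of the open arm.** [cite: Nolin2008, §4.2 (relocation of landing sequences), §4.3 Prop. 12 (proof) (arXiv 0711.4948: Def. 8, Prop. 11)] -/
def uTurnA (r : ℕ) : Set (SiteConfig (Site 2)) :=
  uFenceA r ∩ (⋂ k ∈ Finset.range 10, uBoxA r k) ∩ ⋂ i ∈ Finset.range 90, uCombA r i

/-- Transport of a path of `rotConfig 3 κ` to `κ` (central symmetry). [folklore] -/
theorem pathIn_of_rotConfig_three {A : Set (Site 2)} {κ : SiteConfig (Site 2)} {x y : Site 2}
    (h : PathIn triGraph (A ∩ rotConfig 3 κ) x y) :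
    PathIn triGraph ((triRotIsoPow 3 '' A) ∩ κ) (triRotIsoPow 3 x) (triRotIsoPow 3 y) := by
  refine (pathIn_map_iso (triRotIsoPow 3) h).mono ?_
  rintro _ ⟨v, ⟨hvA, hvκ⟩, rfl⟩
  exact ⟨⟨v, hvA, rfl⟩, mem_rotConfig.1 hvκ⟩

/-- `ρ³ (ρ³ v) = v`. [folklore] -/
theorem rot3_rot3 (v : Site 2) : triRotIsoPow 3 (triRotIsoPow 3 v) = v := by
  rw [← triRotIsoPow_add_apply 3 3 v, triRotIsoPow_six_apply]

/-- Transport of a path of `κ` to `rotConfig 3 κ`. [folklore] -/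
theorem pathIn_rotConfig_three_of {A : Set (Site 2)} {κ : SiteConfig (Site 2)} {x y : Site 2}
    (h : PathIn triGraph (A ∩ κ) x y) :
    PathIn triGraph ((triRotIsoPow 3 '' A) ∩ rotConfig 3 κ) (triRotIsoPow 3 x) (triRotIsoPow 3 y) := by
  refine (pathIn_map_iso (triRotIsoPow 3) h).mono ?_
  rintro _ ⟨v, ⟨hvA, hvκ⟩, rfl⟩
  refine ⟨⟨v, hvA, rfl⟩, ?_⟩
  rw [mem_rotConfig]
  show triRotIsoPow 3 (triRotIsoPow 3 v) ∈ κ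
  rw [rot3_rot3]; exact hvκ

/-- Coordinates of `ρ³ v = -v`. [folklore] -/
theorem rot3_apply (v : Site 2) : (triRotIsoPow 3 v) 0 = -v 0 ∧ (triRotIsoPow 3 v) 1 = -v 1 := by
  obtain ⟨-, -, -, -, -, -, h0, h1, -⟩ := rot_apply_formula v
  exact ⟨h0, h1⟩

/-- Arithmetic helper. [folklore] -/
private theorem castU1 {r : ℕ} (hr : 4096 ≤ r) :
    ((r - r / 8 - 2 - 30 * (r / 64) : ℕ) : ℤ) = (r : ℤ) - (r / 8 : ℕ) - 2 - 30 * (r / 64 : ℕ) := by omega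
/-- Arithmetic helper. [folklore] -/
private theorem castU2 {r : ℕ} (hr : 4096 ≤ r) : ((6 * (r / 64) - 1 : ℕ) : ℤ) = 6 * (r / 64 : ℕ) - 1 := by omega
/-- Arithmetic helper. [folklore] -/
private theorem castU4 {r : ℕ} (hr : 4096 ≤ r) : ((8 * (r / 64) / 8 - 2 : ℕ) : ℤ) = (r / 64 : ℕ) - 2 := by omega

/-- Arithmetic of the open U-turn (floor bookkeeping, proved once in a small context). [folklore] -/
private theorem masterUA {r i : ℕ} (hr : 4096 ≤ r) (hi : i < 90) :
    -(sepGlueHeight r : ℤ) + i * ((r / 64 / 2 : ℕ) : ℤ) + (r / 64 / 2 : ℕ) ≤ 0 ∧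
    (sepGlueHeight r : ℤ) ≤ (r : ℤ) - (r / 8 : ℕ) - (r / 16 : ℕ) - 2 ∧
    ((r / 16 : ℕ) : ℤ) ≤ (r / 8 : ℕ) ∧
    56 * ((r / 64 : ℕ) : ℤ) ≤ (r : ℤ) - (r / 8 : ℕ) ∧
    (r : ℤ) - (r / 8 : ℕ) - 2 + 4 * (r / 64 : ℕ) ≤ r ∧
    8 * (((r / 64 : ℕ) : ℤ)) ≤ (r : ℤ) - (r / 8 : ℕ) - (r / 16 : ℕ) - 2 ∧
    ((8 * (r / 64) / 8 : ℕ) : ℤ) = (r / 64 : ℕ) ∧ ((8 * (r / 64) / 2 : ℕ) : ℤ) = 4 * (r / 64 : ℕ) ∧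
    1 ≤ ((8 * (r / 64) / 64 : ℕ) : ℤ) ∧ 8 * ((8 * (r / 64) / 64 : ℕ) : ℤ) ≤ (r / 64 : ℕ) ∧
    (64 : ℤ) ≤ (r / 64 : ℕ) := by
  have hH := sepGlueHeight_cast r
  have hi' : (i : ℤ) * ((r / 64 / 2 : ℕ) : ℤ) ≤ 89 * ((r / 64 / 2 : ℕ) : ℤ) :=
    mul_le_mul_of_nonneg_right (by exact_mod_cast Nat.le_of_lt_succ hi) (by positivity)
  refine ⟨by omega, by omega, by omega, by omega, by omega, by omega, by omega, by omega, by omega, by omega, by omega⟩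

/-- The thinned new free space of the open U-turn lies in the inner free space of `Λ_{r'}` at the
standard landing point. [folklore] -/
theorem uFenceA_strip_subset {r : ℕ} (hr : 4096 ≤ r) :
    triStrip ((8 * (r / 64) : ℕ) - (8 * (r / 64) / 8 : ℕ) + 1) (-((8 * (r / 64) / 2 : ℕ) : ℤ) - (8 * (r / 64) / 64 : ℕ))
      (8 * (r / 64) / 8 - 2) (2 * (8 * (r / 64) / 64)) ⊆
      sepInnerFence (8 * (r / 64)) ![((8 * (r / 64) : ℕ) : ℤ), -((8 * (r / 64) / 2 : ℕ) : ℤ)] :=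
  sepInCorrFence_subset_sepInnerFence (by omega)

/-- The region of the open U-turn: the norm shell `[r', r]` and the new attaching ball. [folklore] -/
def uRegA (r : ℕ) : Set (Site 2) :=
  shellBall (8 * (r / 64) : ℕ) r (triRotIsoPow 3 ![((8 * (r / 64) : ℕ) : ℤ), -((8 * (r / 64) / 2 : ℕ) : ℤ)]) (r / 64)

set_option maxHeartbeats 800000 in
/-- **The open U-turn, first half**: from the vertical crossing of the old free space of the right side
of `Λ_r` through `u`, the comb, the highway and the first four boxes, to the bottom of the fifth box. [cite: Nolin2008, §4.2 (relocation of landing sequences), §4.3 Prop. 12 (i) (arXiv 0711.4948: Def. 8, Prop. 11)] -/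
theorem uTurnA_glue₁ {r : ℕ} (hr : 4096 ≤ r) {χ : SiteConfig (Site 2)} {z u b t : Site 2} (hz : z ∈ sepLanding r)
    (hb : b 1 = z 1 - (r / 64 : ℕ)) (ht : t 1 = z 1 + (r / 64 : ℕ))
    (p₁ : PathIn triGraph (sepInnerFence r z ∩ χ) b u) (p₂ : PathIn triGraph (sepInnerFence r z ∩ χ) u t)
    (hG : χ ∈ ⋂ i ∈ Finset.range 90, uCombA r i) (h0 : χ ∈ uBoxA r 0) (h1 : χ ∈ uBoxA r 1) (h2 : χ ∈ uBoxA r 2)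
    (h3 : χ ∈ uBoxA r 3) {b₅ t₅ : Site 2} (hb₅ : b₅ 1 = 12 * (r / 64 : ℕ)) (ht₅ : t₅ 1 = 12 * (r / 64 : ℕ) + (14 * (r / 64) : ℕ))
    (PA5 : PathIn triGraph (triStrip (10 * (r / 64 : ℕ)) (12 * (r / 64 : ℕ)) (2 * (r / 64)) (14 * (r / 64)) ∩ χ) b₅ t₅) :
    PathIn triGraph (uRegA r ∩ χ) u b₅ := by
  have hzL := hz; rw [mem_sepLanding] at hzL; obtain ⟨hz0, hz1, hz2⟩ := hzL
  have hHm := sepGlueHeight_cast r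
  have c1 := castU1 hr
  have σF : ∀ v ∈ sepInnerFence r z, (r : ℤ) - (r / 8 : ℕ) ≤ v 0 ∧ v 0 ≤ (r : ℤ) - 1 ∧
      z 1 - (r / 64 : ℕ) ≤ v 1 ∧ v 1 ≤ z 1 + (r / 64 : ℕ) := fun v hv => by
    rw [mem_sepInnerFence] at hv; exact ⟨hv.1, hv.2.1, hv.2.2.1, hv.2.2.2⟩
  have PF : PathIn triGraph (sepInnerFence r z ∩ χ) b t := p₁.trans p₂
  obtain ⟨ah, eh, hah, heh, PHW⟩ := h0
  obtain ⟨a₂, e₂, ha₂, he₂, PA2⟩ := h1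
  obtain ⟨b₃, t₃, hb₃, ht₃, PA3⟩ := h2
  obtain ⟨a₄, e₄, ha₄, he₄, PA4⟩ := h3
  obtain ⟨i, hi, hgi1, hgi2⟩ := exists_sepInComb_rows (by omega : 2200 ≤ r) hz
  obtain ⟨g₀, g₁, hg₀, hg₁, PG⟩ := (Set.mem_iInter₂.1 hG) i (Finset.mem_range.2 hi)
  simp only [Nat.cast_add, Nat.cast_one, Nat.cast_mul, Nat.cast_ofNat] at hg₁ heh ht₃ he₄ ht₅
  rw [c1] at he₂
  have hih : (0 : ℤ) ≤ (i : ℤ) * ((r / 64 / 2 : ℕ) : ℤ) := by positivity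
  obtain ⟨kG, kS, k16, k56, kA2, k8, e8, e2, kt1, kt8, k64⟩ := masterUA (i := i) hr hi
  have F8 := flz r 8 (by norm_num); have F16 := flz r 16 (by norm_num); have F4 := flz r 4 (by norm_num)
  have F64 := flz r 64 (by norm_num); have Fh := flz (r / 64) 2 (by norm_num)
  generalize eq8 : r / 8 = q8 at *
  generalize eq16 : r / 16 = q16 at *
  generalize eq4 : r / 4 = q4 at *
  generalize eq64 : r / 64 = q64 at *
  generalize eqh : q64 / 2 = qh at *
  generalize et8 : 8 * q64 / 8 = t8 at *
  generalize et2 : 8 * q64 / 2 = t2 at *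
  generalize ett : 8 * q64 / 64 = tt at *
  clear eq8 eq16 eq4 eq64 eqh et8 et2 ett
  push_cast at F8 F16 F4 F64 Fh
  have e8' : q64 = t8 := by exact_mod_cast e8.symm
  have e2' : t2 = 4 * q64 := by exact_mod_cast e2
  subst e8'
  subst e2'
  clear e8 e2 kt1 kt8
  have kG0 : (0 : ℤ) ≤ sepGlueHeight r := by positivity
  -- J1: the comb strip `i` meets the old fence crossing
  have Q1 := PathIn.relay (L := (r : ℤ) - q8) (R := (r : ℤ) - 1)
    (B := -(sepGlueHeight r : ℤ) + i * (qh : ℤ)) (T := -(sepGlueHeight r : ℤ) + i * (qh : ℤ) + qh) (by clear c1; omega) (by clear c1; omega)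
    PG (by clear c1; omega) (by clear c1; omega)
    (fun v hv _ _ => by rw [mem_triStrip] at hv; clear c1; omega)
    PF (by clear c1; omega) (by clear c1; omega)
    (fun v hv _ _ => ⟨(σF v hv).1, (σF v hv).2.1⟩)
  -- J2: the comb strip meets the highway
  have Q2 := PathIn.relay (L := (r : ℤ) - q8 - q16 - 2) (R := (r : ℤ) - q8 - 2)
    (B := -(sepGlueHeight r : ℤ) + i * (qh : ℤ)) (T := -(sepGlueHeight r : ℤ) + i * (qh : ℤ) + qh) (by clear c1; omega) (by clear c1; omega)
    PG (by clear c1; omega) (by clear c1; omega)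
    (fun v hv _ _ => by rw [mem_triStrip] at hv; clear c1; omega)
    PHW (by clear c1; omega) (by clear c1; omega)
    (fun v hv _ _ => by rw [mem_triStrip] at hv; clear c1; omega)
  -- J3: the first leftward box meets the highway
  have Q3 := PathIn.relay (L := (r : ℤ) - q8 - q16 - 2) (R := (r : ℤ) - q8 - 2)
    (B := 2 * (q64 : ℤ)) (T := 4 * (q64 : ℤ)) (by clear c1; omega) (by clear c1; omega)
    PA2 (by clear c1; omega) (by clear c1; omega)
    (fun v hv _ _ => by rw [mem_triStrip] at hv; clear c1; omega)
    PHW (by clear c1; omega) (by clear c1; omega)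
    (fun v hv _ _ => by rw [mem_triStrip] at hv; clear c1; omega)
  -- J4: the first leftward box meets the first upward box
  have Q4 := PathIn.relay (L := 30 * (q64 : ℤ)) (R := 32 * (q64 : ℤ)) (B := 2 * (q64 : ℤ)) (T := 4 * (q64 : ℤ)) (by clear c1; omega) (by clear c1; omega)
    PA2 (by clear c1; omega) (by clear c1; omega)
    (fun v hv _ _ => by rw [mem_triStrip] at hv; clear c1; omega)
    PA3 (by clear c1; omega) (by clear c1; omega)
    (fun v hv _ _ => by rw [mem_triStrip] at hv; clear c1; omega)
  -- J5, J6
  have Q5 := PathIn.relay (L := 30 * (q64 : ℤ)) (R := 32 * (q64 : ℤ)) (B := 12 * (q64 : ℤ)) (T := 14 * (q64 : ℤ)) (by clear c1; omega) (by clear c1; omega)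
    PA4 (by clear c1; omega) (by clear c1; omega)
    (fun v hv _ _ => by rw [mem_triStrip] at hv; clear c1; omega)
    PA3 (by clear c1; omega) (by clear c1; omega)
    (fun v hv _ _ => by rw [mem_triStrip] at hv; clear c1; omega)
  have Q6 := PathIn.relay (L := 10 * (q64 : ℤ)) (R := 12 * (q64 : ℤ)) (B := 12 * (q64 : ℤ)) (T := 14 * (q64 : ℤ)) (by clear c1; omega) (by clear c1; omega)
    PA4 (by clear c1; omega) (by clear c1; omega)
    (fun v hv _ _ => by rw [mem_triStrip] at hv; clear c1; omega)
    PA5 (by clear c1; omega) (by clear c1; omega)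
    (fun v hv _ _ => by rw [mem_triStrip] at hv; clear c1; omega)
  -- the regions
  have inF : sepInnerFence r z ⊆ uRegA r := fun v hv => by
    obtain ⟨f1, f2, f3, f4⟩ := σF v hv
    exact mem_shell_of_rightSector (by clear c1; omega) (by clear c1; omega) (by clear c1; omega) (by clear c1; omega)
  have inG : triStrip ((r : ℤ) - q8 - q16 - 2) (-(sepGlueHeight r : ℤ) + i * (qh : ℤ)) (q8 + q16 + 1) qh ⊆ uRegA r := fun v hv => by
    rw [mem_triStrip] at hv
    exact mem_shell_of_rightSector (by clear c1; omega) (by clear c1; omega) (by clear c1; omega) (by clear c1; omega)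
  have inHW : triStrip ((r : ℤ) - q8 - q16 - 2) (-(sepGlueHeight r : ℤ)) q16 (sepGlueHeight r + 4 * q64) ⊆ uRegA r := by
    intro v hv; rw [mem_triStrip] at hv
    rcases le_or_gt (v 1) 0 with h | h
    · exact mem_shell_of_rightSector (by clear c1; omega) (by clear c1; omega) h (by clear c1; omega)
    · exact mem_shell_of_quadrant (by clear c1; omega) (by clear c1; omega) (by clear c1; omega) h.le
  have inA2 : triStrip (30 * (q64 : ℤ)) (2 * (q64 : ℤ)) (r - q8 - 2 - 30 * q64) (2 * q64) ⊆ uRegA r := fun v hv => by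
    rw [mem_triStrip, c1] at hv
    exact mem_shell_of_quadrant (by clear c1; omega) (by clear c1; omega) (by clear c1; omega) (by clear c1; omega)
  have inA3 : triStrip (30 * (q64 : ℤ)) (2 * (q64 : ℤ)) (2 * q64) (12 * q64) ⊆ uRegA r := fun v hv => by
    rw [mem_triStrip] at hv
    exact mem_shell_of_quadrant (by clear c1; omega) (by clear c1; omega) (by clear c1; omega) (by clear c1; omega)
  have inA4 : triStrip (10 * (q64 : ℤ)) (12 * (q64 : ℤ)) (22 * q64) (2 * q64) ⊆ uRegA r := fun v hv => by
    rw [mem_triStrip] at hv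
    exact mem_shell_of_quadrant (by clear c1; omega) (by clear c1; omega) (by clear c1; omega) (by clear c1; omega)
  have inA5 : triStrip (10 * (q64 : ℤ)) (12 * (q64 : ℤ)) (2 * q64) (14 * q64) ⊆ uRegA r := fun v hv => by
    rw [mem_triStrip] at hv
    exact mem_shell_of_quadrant (by clear c1; omega) (by clear c1; omega) (by clear c1; omega) (by clear c1; omega)
  have m2 : ∀ {A B : Set (Site 2)}, A ⊆ uRegA r → B ⊆ uRegA r → (A ∪ B) ∩ χ ⊆ uRegA r ∩ χ := fun hA hB v hv =>
    ⟨hv.1.elim (fun h => hA h) (fun h => hB h), hv.2⟩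
  have K6 := Q6.mono (m2 inA4 inA5)
  have K5 := Q5.mono (m2 inA4 inA3)
  have K4 := Q4.mono (m2 inA2 inA3)
  have K3 := Q3.mono (m2 inA2 inHW)
  have K2 := Q2.mono (m2 inG inHW)
  have K1 := Q1.mono (m2 inG inF)
  have K0 : PathIn triGraph (uRegA r ∩ χ) b u := p₁.mono fun v hv => ⟨inF hv.1, hv.2⟩
  exact (((((K0.symm.trans K1.symm).trans K2).trans K3.symm).trans K4).trans K5.symm).trans K6

set_option maxHeartbeats 800000 in
/-- **The open U-turn, second half**: from the fifth box through the remaining boxes and the connector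
to the new free space of `Λ_{r'}` read through the half turn: a new attaching site `w` with a
crossing of the standard inner free space of `rotConfig 3 χ` through it, joined to the bottom of the
fifth box. [cite: Nolin2008, §4.2 (relocation of landing sequences), §4.3 Prop. 12 (i) (arXiv 0711.4948: Def. 8, Prop. 11)] -/
theorem uTurnA_glue₂ {r : ℕ} (hr : 4096 ≤ r) {χ : SiteConfig (Site 2)}
    (h4 : χ ∈ uBoxA r 4) (h5 : χ ∈ uBoxA r 5) (h6 : χ ∈ uBoxA r 6) (h7 : χ ∈ uBoxA r 7) (h8 : χ ∈ uBoxA r 8) (h9 : χ ∈ uBoxA r 9)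
    (hF : χ ∈ uFenceA r) :
    ∃ (b₅ t₅ w : Site 2), b₅ 1 = 12 * (r / 64 : ℕ) ∧ t₅ 1 = 12 * (r / 64 : ℕ) + (14 * (r / 64) : ℕ) ∧
      PathIn triGraph (triStrip (10 * (r / 64 : ℕ)) (12 * (r / 64 : ℕ)) (2 * (r / 64)) (14 * (r / 64)) ∩ χ) b₅ t₅ ∧
      OpenVCrossThrough (sepInnerFence (8 * (r / 64)) ![((8 * (r / 64) : ℕ) : ℤ), -((8 * (r / 64) / 2 : ℕ) : ℤ)])
        (-((8 * (r / 64) / 2 : ℕ) : ℤ) - (8 * (r / 64) / 64 : ℕ)) (-((8 * (r / 64) / 2 : ℕ) : ℤ) + (8 * (r / 64) / 64 : ℕ)) (rotConfig 3 χ) w ∧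
      PathIn triGraph (uRegA r ∩ χ) b₅ (triRotIsoPow 3 w) := by
  have hIF := uFenceA_strip_subset hr
  have c2 := castU2 hr
  have c4 := castU4 hr
  obtain ⟨b₅, t₅, hb₅, ht₅, PA5⟩ := h4
  obtain ⟨a₆, e₆, ha₆, he₆, PA6⟩ := h5
  obtain ⟨b₇, t₇, hb₇, ht₇, PA7⟩ := h6
  obtain ⟨a₈, e₈, ha₈, he₈, PA8⟩ := h7
  obtain ⟨b₉, t₉, hb₉, ht₉, PA9⟩ := h8
  obtain ⟨ab, eb, hab, heb, PHb⟩ := h9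
  obtain ⟨b₀, t₀, hb₀, ht₀, PV⟩ := hF
  refine ⟨b₅, t₅, ?_⟩
  unfold uRegA
  simp only [Nat.cast_mul, Nat.cast_ofNat] at ht₅ he₆ ht₇ he₈ ht₉ ht₀
  rw [c2] at heb
  obtain ⟨-, -, -, -, -, -, e8, e2, kt1, kt8, k64⟩ := masterUA (i := 0) hr (by norm_num)
  have F64 := flz r 64 (by norm_num)
  generalize eq64 : r / 64 = q64 at *
  generalize et8 : 8 * q64 / 8 = t8 at *
  generalize et2 : 8 * q64 / 2 = t2 at *
  generalize ett : 8 * q64 / 64 = tt at *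
  clear eq64 et8 et2 ett
  push_cast at F64
  have e8' : q64 = t8 := by exact_mod_cast e8.symm
  have e2' : t2 = 4 * q64 := by exact_mod_cast e2
  subst e8'
  subst e2'
  clear e8 e2
  -- J7 … J11
  have Q7 := PathIn.relay (L := 10 * (q64 : ℤ)) (R := 12 * (q64 : ℤ)) (B := 24 * (q64 : ℤ)) (T := 26 * (q64 : ℤ)) (by clear c2 c4; omega) (by clear c2 c4; omega)
    PA6 (by clear c2 c4; omega) (by clear c2 c4; omega)
    (fun v hv _ _ => by rw [mem_triStrip] at hv; clear c2 c4; omega)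
    PA5 (by clear c2 c4; omega) (by clear c2 c4; omega)
    (fun v hv _ _ => by rw [mem_triStrip] at hv; clear c2 c4; omega)
  have Q8 := PathIn.relay (L := -(6 * (q64 : ℤ))) (R := -(4 * (q64 : ℤ))) (B := 24 * (q64 : ℤ)) (T := 26 * (q64 : ℤ)) (by clear c2 c4; omega) (by clear c2 c4; omega)
    PA6 (by clear c2 c4; omega) (by clear c2 c4; omega)
    (fun v hv _ _ => by rw [mem_triStrip] at hv; clear c2 c4; omega)
    PA7 (by clear c2 c4; omega) (by clear c2 c4; omega)
    (fun v hv _ _ => by rw [mem_triStrip] at hv; clear c2 c4; omega)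
  have Q9 := PathIn.relay (L := -(6 * (q64 : ℤ))) (R := -(4 * (q64 : ℤ))) (B := 13 * (q64 : ℤ)) (T := 15 * (q64 : ℤ)) (by clear c2 c4; omega) (by clear c2 c4; omega)
    PA8 (by clear c2 c4; omega) (by clear c2 c4; omega)
    (fun v hv _ _ => by rw [mem_triStrip] at hv; clear c2 c4; omega)
    PA7 (by clear c2 c4; omega) (by clear c2 c4; omega)
    (fun v hv _ _ => by rw [mem_triStrip] at hv; clear c2 c4; omega)
  have Q10 := PathIn.relay (L := -(13 * (q64 : ℤ))) (R := -(11 * (q64 : ℤ))) (B := 13 * (q64 : ℤ)) (T := 15 * (q64 : ℤ)) (by clear c2 c4; omega) (by clear c2 c4; omega)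
    PA8 (by clear c2 c4; omega) (by clear c2 c4; omega)
    (fun v hv _ _ => by rw [mem_triStrip] at hv; clear c2 c4; omega)
    PA9 (by clear c2 c4; omega) (by clear c2 c4; omega)
    (fun v hv _ _ => by rw [mem_triStrip] at hv; clear c2 c4; omega)
  have Q11 := PathIn.relay (L := -(13 * (q64 : ℤ))) (R := -(11 * (q64 : ℤ))) (B := 4 * (q64 : ℤ) - tt) (T := 4 * (q64 : ℤ)) (by clear c2 c4; omega) (by clear c2 c4; omega)
    PHb (by clear c2 c4; omega) (by clear c2 c4; omega)
    (fun v hv _ _ => by rw [mem_triStrip] at hv; clear c2 c4; omega)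
    PA9 (by clear c2 c4; omega) (by clear c2 c4; omega)
    (fun v hv _ _ => by rw [mem_triStrip] at hv; clear c2 c4; omega)
  -- J12: the connector meets the new free space (read through the half turn)
  obtain ⟨SV, hSV, PV', TV⟩ := PV.exists_support
  have PVχ : PathIn triGraph ((triRotIsoPow 3 '' SV) ∩ χ) (triRotIsoPow 3 t₀) (triRotIsoPow 3 b₀) := by
    have h := PV'.symm.mono (show SV ⊆ SV ∩ rotConfig 3 χ from fun v hv => ⟨hv, (hSV hv).2⟩)
    exact pathIn_of_rotConfig_three h
  obtain ⟨Sb, hSb, PHb', Tb⟩ := PHb.exists_support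
  obtain ⟨rb0, rb1⟩ := rot3_apply b₀
  obtain ⟨rt0, rt1⟩ := rot3_apply t₀
  have hab' : ab 0 ≤ -(8 * (q64 : ℤ)) + 1 := by rw [hab]; clear c2 c4; omega
  obtain ⟨p, hpB, hpV⟩ := exists_mem_of_cross (L := -(8 * (q64 : ℤ)) + 1) (R := -(7 * (q64 : ℤ)) - 1)
    (B := 4 * (q64 : ℤ) - tt) (T := 4 * (q64 : ℤ)) (by clear c2 c4; omega) (by clear c2 c4; omega)
    PHb' hab' (by rw [heb]; clear c2 c4; omega)
    (fun v hv _ _ => by have h := (hSb hv).1; rw [mem_triStrip] at h; clear c2 c4; omega)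
    PVχ (by rw [rt1, ht₀]; clear c2 c4; omega) (by rw [rb1, hb₀]; clear c2 c4; omega)
    (fun v hv _ _ => by
      obtain ⟨w, hw, hwv⟩ := hv.1
      have h := (hSV hw).1
      rw [mem_triStrip, c4] at h
      obtain ⟨r0, -⟩ := rot3_apply w
      have hv0 : v 0 = -w 0 := by rw [← hwv]; exact r0
      clear c2 c4
      push_cast at h
      omega)
  obtain ⟨w₆, hw₆, hw₆p⟩ : ∃ w₆ ∈ SV, triRotIsoPow 3 w₆ = p := by
    obtain ⟨w, hw, hwp⟩ := hpV.1; exact ⟨w, hw, hwp⟩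
  set Z : Site 2 := ![((8 * q64 : ℕ) : ℤ), -((4 * q64 : ℕ) : ℤ)] with hZ
  have hSVF : SV ⊆ sepInnerFence (8 * q64) Z ∩ rotConfig 3 χ := fun v hv => ⟨hIF (hSV hv).1, (hSV hv).2⟩
  have hFence : OpenVCrossThrough (sepInnerFence (8 * q64) Z) (-((4 * q64 : ℕ) : ℤ) - (tt : ℕ)) (-((4 * q64 : ℕ) : ℤ) + (tt : ℕ)) (rotConfig 3 χ) w₆ :=
    ⟨b₀, t₀, hb₀, by rw [ht₀]; ring, (TV w₆ hw₆).mono hSVF, ((TV w₆ hw₆).symm.trans (TV t₀ PV'.right_mem)).mono hSVF⟩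
  refine ⟨w₆, hb₅, by rw [ht₅]; push_cast; ring, PA5, hFence, ?_⟩
  -- the regions
  obtain ⟨zn0, zn1⟩ := rot3_apply Z
  have ez0 : Z 0 = ((8 * q64 : ℕ) : ℤ) := site_mk_apply_zero _ _
  have ez1 : Z 1 = -((4 * q64 : ℕ) : ℤ) := site_mk_apply_one _ _
  rw [ez0] at zn0; rw [ez1] at zn1
  push_cast at zn0 zn1
  set Rg := shellBall ((8 * q64 : ℕ) : ℤ) r (triRotIsoPow 3 Z) q64 with hRg
  have inA5 : triStrip (10 * (q64 : ℤ)) (12 * (q64 : ℤ)) (2 * q64) (14 * q64) ⊆ Rg := fun v hv => by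
    rw [mem_triStrip] at hv
    exact mem_shell_of_quadrant (by clear c2 c4; omega) (by clear c2 c4; omega) (by clear c2 c4; omega) (by clear c2 c4; omega)
  have inA6 : triStrip (-(6 * (q64 : ℤ))) (24 * (q64 : ℤ)) (18 * q64) (2 * q64) ⊆ Rg := by
    intro v hv; rw [mem_triStrip] at hv
    rcases le_or_gt (v 0) 0 with h | h
    · exact mem_shell_of_topSector (by clear c2 c4; omega) (by clear c2 c4; omega) h (by clear c2 c4; omega)
    · exact mem_shell_of_quadrant (by clear c2 c4; omega) (by clear c2 c4; omega) h.le (by clear c2 c4; omega)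
  have inA7 : triStrip (-(6 * (q64 : ℤ))) (13 * (q64 : ℤ)) (2 * q64) (13 * q64) ⊆ Rg := fun v hv => by
    rw [mem_triStrip] at hv
    exact mem_shell_of_topSector (by clear c2 c4; omega) (by clear c2 c4; omega) (by clear c2 c4; omega) (by clear c2 c4; omega)
  have inA8 : triStrip (-(13 * (q64 : ℤ))) (13 * (q64 : ℤ)) (9 * q64) (2 * q64) ⊆ Rg := by
    intro v hv; rw [mem_triStrip] at hv
    rcases le_or_gt 0 (v 0 + v 1) with h | h
    · exact mem_shell_of_topSector (by clear c2 c4; omega) (by clear c2 c4; omega) (by clear c2 c4; omega) h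
    · exact mem_shell_of_leftUpper (by clear c2 c4; omega) (by clear c2 c4; omega) (by clear c2 c4; omega) h.le
  have inA9 : triStrip (-(13 * (q64 : ℤ))) (3 * (q64 : ℤ)) (2 * q64) (12 * q64) ⊆ Rg := by
    intro v hv; rw [mem_triStrip] at hv
    rcases le_or_gt 0 (v 0 + v 1) with h | h
    · exact mem_shell_of_topSector (by clear c2 c4; omega) (by clear c2 c4; omega) (by clear c2 c4; omega) h
    · exact mem_shell_of_leftUpper (by clear c2 c4; omega) (by clear c2 c4; omega) (by clear c2 c4; omega) h.le
  have inHb : triStrip (-(13 * (q64 : ℤ))) (4 * (q64 : ℤ) - tt) (6 * q64 - 1) tt ⊆ Rg := by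
    intro v hv; rw [mem_triStrip, c2] at hv
    rcases le_or_gt (v 0) (-(8 * (q64 : ℤ))) with h | h
    · exact mem_shell_of_leftUpper (by clear c2 c4; omega) (by clear c2 c4; omega) (by clear c2 c4; omega) (by clear c2 c4; omega)
    · exact mem_shell_of_near (by rw [zn0]; clear c2 c4; omega) (by rw [zn0]; clear c2 c4; omega) (by rw [zn1]; clear c2 c4; omega)
        (by rw [zn1]; clear c2 c4; omega) (by rw [zn0, zn1]; clear c2 c4; omega) (by rw [zn0, zn1]; clear c2 c4; omega)
  have m2 : ∀ {A B : Set (Site 2)}, A ⊆ Rg → B ⊆ Rg → (A ∪ B) ∩ χ ⊆ Rg ∩ χ := fun hA hB v hv =>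
    ⟨hv.1.elim (fun h => hA h) (fun h => hB h), hv.2⟩
  have K12 : PathIn triGraph (Rg ∩ χ) ab p := (Tb p hpB).mono fun v hv => ⟨inHb (hSb hv).1, (hSb hv).2⟩
  have K11 := Q11.mono (m2 inHb inA9)
  have K10 := Q10.mono (m2 inA8 inA9)
  have K9 := Q9.mono (m2 inA8 inA7)
  have K8 := Q8.mono (m2 inA6 inA7)
  have K7 := Q7.mono (m2 inA6 inA5)
  rw [hw₆p]
  exact ((((K7.symm.trans K8).trans K9.symm).trans K10).trans K11.symm).trans K12

/-- **The open U-turn glued to the old free space of the right side.** From the vertical crossing of the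
old free space of the right side of `Λ_r` through `u` and `χ ∈ uTurnA r`: a new attaching site `w` with
a crossing of the standard inner free space of `Λ_{r'}` (`r' = 8 ⌊r/64⌋`) of `rotConfig 3 χ` through
it, joined to `u` inside `χ` through sites of `uRegA r`. [cite: Nolin2008, §4.2 (relocation of landing sequences), §4.3 Prop. 12 (i) (arXiv 0711.4948: Def. 8, Prop. 11)] -/
theorem uTurnA_glue {r : ℕ} (hr : 4096 ≤ r) {χ : SiteConfig (Site 2)} {z u b t : Site 2} (hz : z ∈ sepLanding r)
    (hb : b 1 = z 1 - (r / 64 : ℕ)) (ht : t 1 = z 1 + (r / 64 : ℕ))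
    (p₁ : PathIn triGraph (sepInnerFence r z ∩ χ) b u) (p₂ : PathIn triGraph (sepInnerFence r z ∩ χ) u t)
    (hA : χ ∈ uTurnA r) :
    ∃ w : Site 2, OpenVCrossThrough (sepInnerFence (8 * (r / 64)) ![((8 * (r / 64) : ℕ) : ℤ), -((8 * (r / 64) / 2 : ℕ) : ℤ)])
        (-((8 * (r / 64) / 2 : ℕ) : ℤ) - (8 * (r / 64) / 64 : ℕ)) (-((8 * (r / 64) / 2 : ℕ) : ℤ) + (8 * (r / 64) / 64 : ℕ)) (rotConfig 3 χ) w ∧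
      PathIn triGraph (uRegA r ∩ χ) u (triRotIsoPow 3 w) := by
  obtain ⟨⟨hF, hK⟩, hG⟩ := hA
  have hK' := fun k (hk : k < 10) => (Set.mem_iInter₂.1 hK) k (Finset.mem_range.2 hk)
  obtain ⟨b₅, t₅, w, hb₅, ht₅, PA5, hFence, P2⟩ := uTurnA_glue₂ hr (hK' 4 (by norm_num)) (hK' 5 (by norm_num)) (hK' 6 (by norm_num))
    (hK' 7 (by norm_num)) (hK' 8 (by norm_num)) (hK' 9 (by norm_num)) hF
  have P1 := uTurnA_glue₁ hr hz hb ht p₁ p₂ hG (hK' 0 (by norm_num)) (hK' 1 (by norm_num)) (hK' 2 (by norm_num)) (hK' 3 (by norm_num))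
    hb₅ ht₅ PA5
  exact ⟨w, hFence, P1.trans P2⟩

/-! ### The U-turn corridor of the closed arm (side `2` of `Λ_r` to side `5` of `Λ_{r'}`) -/

/-- The ten single boxes of the closed U-turn between the comb and the target free space, in the
coordinates of the colour-exchanged configuration `κ` (whose top-side reflection carries the old
fence), indexed by `0, …, 9`: the highway leftward along the top side, then alternately downward and
rightward boxes through the sectors of the sides `3` and `4`, rightward below `Λ_{r'}` and the vertical
connector up into the free space of its bottom side (`e = ⌊r/64⌋`, `r' = 8e`, `t = ⌊r'/64⌋`). [cite: Nolin2008, §4.2 (relocation of landing sequences) (arXiv 0711.4948: Def. 8, Fig. 6)] -/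
def uBoxB (r : ℕ) : ℕ → Set (SiteConfig (Site 2))
  | 0 => triHCross (-(55 * (r / 64 : ℕ) : ℤ)) ((r : ℤ) - (r / 8 : ℕ) - (r / 16 : ℕ) - 2) (55 * (r / 64)) (r / 16)
  | 1 => triVCross (-(50 * (r / 64 : ℕ) : ℤ)) (30 * (r / 64 : ℕ)) (2 * (r / 64)) (r - r / 8 - 2 - 30 * (r / 64))
  | 2 => triHCross (-(50 * (r / 64 : ℕ) : ℤ)) (30 * (r / 64 : ℕ)) (16 * (r / 64)) (2 * (r / 64))
  | 3 => triVCross (-(36 * (r / 64 : ℕ) : ℤ)) (10 * (r / 64 : ℕ)) (2 * (r / 64)) (22 * (r / 64))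
  | 4 => triHCross (-(36 * (r / 64 : ℕ) : ℤ)) (10 * (r / 64 : ℕ)) (16 * (r / 64)) (2 * (r / 64))
  | 5 => triVCross (-(22 * (r / 64 : ℕ) : ℤ)) (-(4 * (r / 64 : ℕ) : ℤ)) (2 * (r / 64)) (16 * (r / 64))
  | 6 => triHCross (-(22 * (r / 64 : ℕ) : ℤ)) (-(4 * (r / 64 : ℕ) : ℤ)) (15 * (r / 64)) (2 * (r / 64))
  | 7 => triVCross (-(9 * (r / 64 : ℕ) : ℤ)) (-(11 * (r / 64 : ℕ) : ℤ)) (2 * (r / 64)) (9 * (r / 64))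
  | 8 => triHCross (-(9 * (r / 64 : ℕ) : ℤ)) (-(11 * (r / 64 : ℕ) : ℤ)) (13 * (r / 64)) (2 * (r / 64))
  | 9 => triVCross (4 * (r / 64 : ℕ) - (8 * (r / 64) / 64 : ℕ)) (-(11 * (r / 64 : ℕ) : ℤ)) (8 * (r / 64) / 64) (4 * (r / 64) - 1)
  | _ => Set.univ

/-- The thinned new free space of the closed U-turn: the free space of the right side of `Λ_{r'}`,
read through the reflection frame `5` (so it lies at the bottom side). [cite: Nolin2008, §4.2 Def. 6–7 (arXiv 0711.4948: Def. 6–7)] -/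
def uFenceB (r : ℕ) : Set (SiteConfig (Site 2)) :=
  {κ | frameConfig 5 κ ∈ triVCross ((8 * (r / 64) : ℕ) - (8 * (r / 64) / 8 : ℕ) + 1)
    (-((8 * (r / 64) / 2 : ℕ) : ℤ) - (8 * (r / 64) / 64 : ℕ)) (8 * (r / 64) / 8 - 2) (2 * (8 * (r / 64) / 64))}

/-- **The U-turn corridor of the closed arm** (in the coordinates of the colour-exchanged
configuration; the comb is that of `inBent`). [cite: Nolin2008, §4.2 (relocation of landing sequences), §4.3 Prop. 12 (proof) (arXiv 0711.4948: Def. 8, Prop. 11)] -/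
def uTurnB (r : ℕ) : Set (SiteConfig (Site 2)) :=
  uFenceB r ∩ (⋂ k ∈ Finset.range 10, uBoxB r k) ∩ ⋂ i ∈ Finset.range 90, inCombB r i

/-- The region of the closed U-turn: the norm shell `[r', r]` and the new attaching ball. [folklore] -/
def uRegB (r : ℕ) : Set (Site 2) :=
  shellBall (8 * (r / 64) : ℕ) r (frameIso 5 ![((8 * (r / 64) : ℕ) : ℤ), -((8 * (r / 64) / 2 : ℕ) : ℤ)]) (r / 64)

/-- Transport of a path of `frameConfig 5 κ` to `κ`. [folklore] -/
theorem pathIn_of_frameConfig_five {A : Set (Site 2)} {κ : SiteConfig (Site 2)} {x y : Site 2}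
    (h : PathIn triGraph (A ∩ frameConfig 5 κ) x y) :
    PathIn triGraph ((frameIso 5 '' A) ∩ κ) (frameIso 5 x) (frameIso 5 y) := by
  refine (pathIn_map_iso (frameIso 5) h).mono ?_
  rintro _ ⟨v, ⟨hvA, hvκ⟩, rfl⟩
  exact ⟨⟨v, hvA, rfl⟩, mem_frameConfig.1 hvκ⟩

/-- Coordinates of `frameIso 5 v` (the reflection `(x, y) ↦ (-y, -x)`). [folklore] -/
theorem frameIso5_apply (v : Site 2) : (frameIso 5 v) 0 = -v 1 ∧ (frameIso 5 v) 1 = -v 0 := by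
  obtain ⟨-, -, -, -, -, -, -, -, -, -, h0, h1⟩ := frameIso_apply_formula v
  exact ⟨h0, h1⟩

/-- Arithmetic helper. [folklore] -/
private theorem castU5 {r : ℕ} (hr : 4096 ≤ r) : ((4 * (r / 64) - 1 : ℕ) : ℤ) = 4 * (r / 64 : ℕ) - 1 := by omega

/-- Arithmetic of the closed U-turn. [folklore] -/
private theorem masterUB {r i : ℕ} (hr : 4096 ≤ r) (hi : i < 90) :
    -(sepGlueHeight r : ℤ) + i * ((r / 64 / 2 : ℕ) : ℤ) + (r / 64 / 2 : ℕ) ≤ 0 ∧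
    (sepGlueHeight r : ℤ) ≤ (r : ℤ) - (r / 8 : ℕ) - (r / 16 : ℕ) - 2 ∧
    (sepGlueHeight r : ℤ) ≤ 55 * (r / 64 : ℕ) ∧
    56 * ((r / 64 : ℕ) : ℤ) ≤ (r : ℤ) - (r / 8 : ℕ) ∧
    (r : ℤ) - (r / 8 : ℕ) - 2 + 4 * (r / 64 : ℕ) ≤ r ∧
    ((8 * (r / 64) / 8 : ℕ) : ℤ) = (r / 64 : ℕ) ∧ ((8 * (r / 64) / 2 : ℕ) : ℤ) = 4 * (r / 64 : ℕ) ∧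
    1 ≤ ((8 * (r / 64) / 64 : ℕ) : ℤ) ∧ 8 * ((8 * (r / 64) / 64 : ℕ) : ℤ) ≤ (r / 64 : ℕ) ∧
    (64 : ℤ) ≤ (r / 64 : ℕ) := by
  have hH := sepGlueHeight_cast r
  have hi' : (i : ℤ) * ((r / 64 / 2 : ℕ) : ℤ) ≤ 89 * ((r / 64 / 2 : ℕ) : ℤ) :=
    mul_le_mul_of_nonneg_right (by exact_mod_cast Nat.le_of_lt_succ hi) (by positivity)
  refine ⟨by omega, by omega, by omega, by omega, by omega, by omega, by omega, by omega, by omega, by omega⟩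

/-- The thinned new free space of the closed U-turn lies in the standard inner free space. [folklore] -/
theorem uFenceB_strip_subset {r : ℕ} (hr : 4096 ≤ r) :
    triStrip ((8 * (r / 64) : ℕ) - (8 * (r / 64) / 8 : ℕ) + 1) (-((8 * (r / 64) / 2 : ℕ) : ℤ) - (8 * (r / 64) / 64 : ℕ))
      (8 * (r / 64) / 8 - 2) (2 * (8 * (r / 64) / 64)) ⊆
      sepInnerFence (8 * (r / 64)) ![((8 * (r / 64) : ℕ) : ℤ), -((8 * (r / 64) / 2 : ℕ) : ℤ)] :=
  sepInCorrFence_subset_sepInnerFence (by omega)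

set_option maxHeartbeats 800000 in
/-- **The closed U-turn, first half**: from the horizontal (in `κ`) crossing of the old top-side free
space through `frameIso 2 u`, the comb, the highway and the boxes down the left, to the bottom of the
box `5`. [cite: Nolin2008, §4.2 (relocation of landing sequences), §4.3 Prop. 12 (i) (arXiv 0711.4948: Def. 8, Prop. 11)] -/
theorem uTurnB_glue₁ {r : ℕ} (hr : 4096 ≤ r) {κ : SiteConfig (Site 2)} {z u b t : Site 2} (hz : z ∈ sepLanding r)
    (hb : b 1 = z 1 - (r / 64 : ℕ)) (ht : t 1 = z 1 + (r / 64 : ℕ))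
    (p₁ : PathIn triGraph (sepInnerFence r z ∩ frameConfig 2 κ) b u) (p₂ : PathIn triGraph (sepInnerFence r z ∩ frameConfig 2 κ) u t)
    (hG : κ ∈ ⋂ i ∈ Finset.range 90, inCombB r i) (h0 : κ ∈ uBoxB r 0) (h1 : κ ∈ uBoxB r 1) (h2 : κ ∈ uBoxB r 2)
    (h3 : κ ∈ uBoxB r 3) (h4 : κ ∈ uBoxB r 4) {b₅ t₅ : Site 2} (hb₅ : b₅ 1 = -(4 * (r / 64 : ℕ) : ℤ))
    (ht₅ : t₅ 1 = -(4 * (r / 64 : ℕ) : ℤ) + (16 * (r / 64) : ℕ))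
    (PB5 : PathIn triGraph (triStrip (-(22 * (r / 64 : ℕ) : ℤ)) (-(4 * (r / 64 : ℕ) : ℤ)) (2 * (r / 64)) (16 * (r / 64)) ∩ κ) b₅ t₅) :
    PathIn triGraph (uRegB r ∩ κ) (frameIso 2 u) b₅ := by
  have hzL := hz; rw [mem_sepLanding] at hzL; obtain ⟨hz0, hz1, hz2⟩ := hzL
  have hHm := sepGlueHeight_cast r
  have c1 := castU1 hr
  have P₁ := pathIn_of_frameConfig_two p₁
  have σF : ∀ v ∈ frameIso 2 '' sepInnerFence r z, (r : ℤ) - (r / 8 : ℕ) ≤ v 1 ∧ v 1 ≤ (r : ℤ) - 1 ∧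
      z 1 - (r / 64 : ℕ) ≤ v 0 ∧ v 0 ≤ z 1 + (r / 64 : ℕ) := by
    rintro _ ⟨w, hw, rfl⟩
    rw [mem_sepInnerFence] at hw
    obtain ⟨e0, e1⟩ := frameIso2_apply w
    exact ⟨e1 ▸ hw.1, e1 ▸ hw.2.1, e0 ▸ hw.2.2.1, e0 ▸ hw.2.2.2⟩
  obtain ⟨eb0, -⟩ := frameIso2_apply b
  obtain ⟨et0, -⟩ := frameIso2_apply t
  have PF := pathIn_of_frameConfig_two (p₁.trans p₂)
  obtain ⟨ah, eh, hah, heh, PHW⟩ := h0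
  obtain ⟨b₁, t₁, hb₁, ht₁, PB1⟩ := h1
  obtain ⟨a₂, e₂, ha₂, he₂, PB2⟩ := h2
  obtain ⟨b₃, t₃, hb₃, ht₃, PB3⟩ := h3
  obtain ⟨a₄, e₄, ha₄, he₄, PB4⟩ := h4
  obtain ⟨i, hi, hgi1, hgi2⟩ := exists_sepInComb_rows (by omega : 2200 ≤ r) hz
  obtain ⟨g₀, g₁, hg₀, hg₁, PG⟩ := (Set.mem_iInter₂.1 hG) i (Finset.mem_range.2 hi)
  simp only [Nat.cast_add, Nat.cast_one, Nat.cast_mul, Nat.cast_ofNat] at hg₁ heh he₂ ht₃ he₄ ht₅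
  rw [c1] at ht₁
  have hih : (0 : ℤ) ≤ (i : ℤ) * ((r / 64 / 2 : ℕ) : ℤ) := by positivity
  obtain ⟨kG, kS, k55, k56, kA2, e8, e2, kt1, kt8, k64⟩ := masterUB (i := i) hr hi
  have F8 := flz r 8 (by norm_num); have F16 := flz r 16 (by norm_num); have F4 := flz r 4 (by norm_num)
  have F64 := flz r 64 (by norm_num); have Fh := flz (r / 64) 2 (by norm_num)
  generalize eq8 : r / 8 = q8 at *
  generalize eq16 : r / 16 = q16 at *
  generalize eq4 : r / 4 = q4 at *
  generalize eq64 : r / 64 = q64 at *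
  generalize eqh : q64 / 2 = qh at *
  generalize et8 : 8 * q64 / 8 = t8 at *
  generalize et2 : 8 * q64 / 2 = t2 at *
  generalize ett : 8 * q64 / 64 = tt at *
  clear eq8 eq16 eq4 eq64 eqh et8 et2 ett
  push_cast at F8 F16 F4 F64 Fh
  have e8' : q64 = t8 := by exact_mod_cast e8.symm
  have e2' : t2 = 4 * q64 := by exact_mod_cast e2
  subst e8'
  subst e2'
  clear e8 e2 kt1 kt8
  have kG0 : (0 : ℤ) ≤ sepGlueHeight r := by positivity
  -- J1: the old fence crossing (horizontal in `κ`) meets the comb strip `i`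
  have Q1 := PathIn.relay (L := -(sepGlueHeight r : ℤ) + i * (qh : ℤ)) (R := -(sepGlueHeight r : ℤ) + i * (qh : ℤ) + qh)
    (B := (r : ℤ) - q8) (T := (r : ℤ) - 1) (by clear c1; omega) (by clear c1; omega) PF (by rw [eb0]; clear c1; omega) (by rw [et0]; clear c1; omega)
    (fun v hv _ _ => ⟨(σF v hv).1, (σF v hv).2.1⟩) PG (by clear c1; omega) (by clear c1; omega)
    (fun v hv _ _ => by rw [mem_triStrip] at hv; clear c1; omega)
  -- J2: the highway meets the comb strip
  have Q2 := PathIn.relay (L := -(sepGlueHeight r : ℤ) + i * (qh : ℤ)) (R := -(sepGlueHeight r : ℤ) + i * (qh : ℤ) + qh)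
    (B := (r : ℤ) - q8 - q16 - 2) (T := (r : ℤ) - q8 - 2) (by clear c1; omega) (by clear c1; omega) PHW (by clear c1; omega) (by clear c1; omega)
    (fun v hv _ _ => by rw [mem_triStrip] at hv; clear c1; omega) PG (by clear c1; omega) (by clear c1; omega)
    (fun v hv _ _ => by rw [mem_triStrip] at hv; clear c1; omega)
  -- J3: the highway meets the first downward box
  have Q3 := PathIn.relay (L := -(50 * (q64 : ℤ))) (R := -(48 * (q64 : ℤ)))
    (B := (r : ℤ) - q8 - q16 - 2) (T := (r : ℤ) - q8 - 2) (by clear c1; omega) (by clear c1; omega) PHW (by clear c1; omega) (by clear c1; omega)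
    (fun v hv _ _ => by rw [mem_triStrip] at hv; clear c1; omega) PB1 (by clear c1; omega) (by clear c1; omega)
    (fun v hv _ _ => by rw [mem_triStrip] at hv; clear c1; omega)
  -- J4: the first rightward box meets the first downward box
  have Q4 := PathIn.relay (L := -(50 * (q64 : ℤ))) (R := -(48 * (q64 : ℤ))) (B := 30 * (q64 : ℤ)) (T := 32 * (q64 : ℤ))
    (by clear c1; omega) (by clear c1; omega) PB2 (by clear c1; omega) (by clear c1; omega)
    (fun v hv _ _ => by rw [mem_triStrip] at hv; clear c1; omega) PB1 (by clear c1; omega) (by clear c1; omega)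
    (fun v hv _ _ => by rw [mem_triStrip] at hv; clear c1; omega)
  -- J5, J6, J7
  have Q5 := PathIn.relay (L := -(36 * (q64 : ℤ))) (R := -(34 * (q64 : ℤ))) (B := 30 * (q64 : ℤ)) (T := 32 * (q64 : ℤ))
    (by clear c1; omega) (by clear c1; omega) PB2 (by clear c1; omega) (by clear c1; omega)
    (fun v hv _ _ => by rw [mem_triStrip] at hv; clear c1; omega) PB3 (by clear c1; omega) (by clear c1; omega)
    (fun v hv _ _ => by rw [mem_triStrip] at hv; clear c1; omega)
  have Q6 := PathIn.relay (L := -(36 * (q64 : ℤ))) (R := -(34 * (q64 : ℤ))) (B := 10 * (q64 : ℤ)) (T := 12 * (q64 : ℤ))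
    (by clear c1; omega) (by clear c1; omega) PB4 (by clear c1; omega) (by clear c1; omega)
    (fun v hv _ _ => by rw [mem_triStrip] at hv; clear c1; omega) PB3 (by clear c1; omega) (by clear c1; omega)
    (fun v hv _ _ => by rw [mem_triStrip] at hv; clear c1; omega)
  have Q7 := PathIn.relay (L := -(22 * (q64 : ℤ))) (R := -(20 * (q64 : ℤ))) (B := 10 * (q64 : ℤ)) (T := 12 * (q64 : ℤ))
    (by clear c1; omega) (by clear c1; omega) PB4 (by clear c1; omega) (by clear c1; omega)
    (fun v hv _ _ => by rw [mem_triStrip] at hv; clear c1; omega) PB5 (by clear c1; omega) (by clear c1; omega)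
    (fun v hv _ _ => by rw [mem_triStrip] at hv; clear c1; omega)
  -- the regions
  have inF : frameIso 2 '' sepInnerFence r z ⊆ uRegB r := fun v hv => by
    obtain ⟨f1, f2, f3, f4⟩ := σF v hv
    exact mem_shell_of_topSector (by clear c1; omega) (by clear c1; omega) (by clear c1; omega) (by clear c1; omega)
  have inG : triStrip (-(sepGlueHeight r : ℤ) + i * (qh : ℤ)) ((r : ℤ) - q8 - q16 - 2) qh (q8 + q16 + 1) ⊆ uRegB r := fun v hv => by
    rw [mem_triStrip] at hv
    exact mem_shell_of_topSector (by clear c1; omega) (by clear c1; omega) (by clear c1; omega) (by clear c1; omega)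
  have inHW : triStrip (-(55 * (q64 : ℤ))) ((r : ℤ) - q8 - q16 - 2) (55 * q64) q16 ⊆ uRegB r := by
    intro v hv; rw [mem_triStrip] at hv
    rcases le_or_gt 0 (v 0 + v 1) with h | h
    · exact mem_shell_of_topSector (by clear c1; omega) (by clear c1; omega) (by clear c1; omega) h
    · exact mem_shell_of_leftUpper (by clear c1; omega) (by clear c1; omega) (by clear c1; omega) h.le
  have inB1 : triStrip (-(50 * (q64 : ℤ))) (30 * (q64 : ℤ)) (2 * q64) (r - q8 - 2 - 30 * q64) ⊆ uRegB r := by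
    intro v hv; rw [mem_triStrip, c1] at hv
    rcases le_or_gt 0 (v 0 + v 1) with h | h
    · exact mem_shell_of_topSector (by clear c1; omega) (by clear c1; omega) (by clear c1; omega) h
    · exact mem_shell_of_leftUpper (by clear c1; omega) (by clear c1; omega) (by clear c1; omega) h.le
  have inB2 : triStrip (-(50 * (q64 : ℤ))) (30 * (q64 : ℤ)) (16 * q64) (2 * q64) ⊆ uRegB r := fun v hv => by
    rw [mem_triStrip] at hv
    exact mem_shell_of_leftUpper (by clear c1; omega) (by clear c1; omega) (by clear c1; omega) (by clear c1; omega)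
  have inB3 : triStrip (-(36 * (q64 : ℤ))) (10 * (q64 : ℤ)) (2 * q64) (22 * q64) ⊆ uRegB r := fun v hv => by
    rw [mem_triStrip] at hv
    exact mem_shell_of_leftUpper (by clear c1; omega) (by clear c1; omega) (by clear c1; omega) (by clear c1; omega)
  have inB4 : triStrip (-(36 * (q64 : ℤ))) (10 * (q64 : ℤ)) (16 * q64) (2 * q64) ⊆ uRegB r := fun v hv => by
    rw [mem_triStrip] at hv
    exact mem_shell_of_leftUpper (by clear c1; omega) (by clear c1; omega) (by clear c1; omega) (by clear c1; omega)
  have inB5 : triStrip (-(22 * (q64 : ℤ))) (-(4 * (q64 : ℤ))) (2 * q64) (16 * q64) ⊆ uRegB r := by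
    intro v hv; rw [mem_triStrip] at hv
    rcases le_or_gt 0 (v 1) with h | h
    · exact mem_shell_of_leftUpper (by clear c1; omega) (by clear c1; omega) h (by clear c1; omega)
    · exact mem_shell_of_lowerLeft (by clear c1; omega) (by clear c1; omega) (by clear c1; omega) h.le
  have m2 : ∀ {A B : Set (Site 2)}, A ⊆ uRegB r → B ⊆ uRegB r → (A ∪ B) ∩ κ ⊆ uRegB r ∩ κ := fun hA hB v hv =>
    ⟨hv.1.elim (fun h => hA h) (fun h => hB h), hv.2⟩
  have K7 := Q7.mono (m2 inB4 inB5)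
  have K6 := Q6.mono (m2 inB4 inB3)
  have K5 := Q5.mono (m2 inB2 inB3)
  have K4 := Q4.mono (m2 inB2 inB1)
  have K3 := Q3.mono (m2 inHW inB1)
  have K2 := Q2.mono (m2 inHW inG)
  have K1 := Q1.mono (m2 inF inG)
  have K0 : PathIn triGraph (uRegB r ∩ κ) (frameIso 2 b) (frameIso 2 u) := P₁.mono fun v hv => ⟨inF hv.1, hv.2⟩
  exact ((((((K0.symm.trans K1).trans K2.symm).trans K3).trans K4.symm).trans K5).trans K6.symm).trans K7

set_option maxHeartbeats 800000 in
/-- **The closed U-turn, second half**: from the box `5` through the remaining boxes and the vertical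
connector to the new free space of the bottom side of `Λ_{r'}` (read through the reflection frame `5`):
a new attaching site `w` with a crossing of the standard inner free space of `frameConfig 5 κ` through
it, joined to the bottom of the box `5`. [cite: Nolin2008, §4.2 (relocation of landing sequences), §4.3 Prop. 12 (i) (arXiv 0711.4948: Def. 8, Prop. 11)] -/
theorem uTurnB_glue₂ {r : ℕ} (hr : 4096 ≤ r) {κ : SiteConfig (Site 2)}
    (h5 : κ ∈ uBoxB r 5) (h6 : κ ∈ uBoxB r 6) (h7 : κ ∈ uBoxB r 7) (h8 : κ ∈ uBoxB r 8) (h9 : κ ∈ uBoxB r 9)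
    (hF : κ ∈ uFenceB r) :
    ∃ (b₅ t₅ w : Site 2), b₅ 1 = -(4 * (r / 64 : ℕ) : ℤ) ∧ t₅ 1 = -(4 * (r / 64 : ℕ) : ℤ) + (16 * (r / 64) : ℕ) ∧
      PathIn triGraph (triStrip (-(22 * (r / 64 : ℕ) : ℤ)) (-(4 * (r / 64 : ℕ) : ℤ)) (2 * (r / 64)) (16 * (r / 64)) ∩ κ) b₅ t₅ ∧
      OpenVCrossThrough (sepInnerFence (8 * (r / 64)) ![((8 * (r / 64) : ℕ) : ℤ), -((8 * (r / 64) / 2 : ℕ) : ℤ)])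
        (-((8 * (r / 64) / 2 : ℕ) : ℤ) - (8 * (r / 64) / 64 : ℕ)) (-((8 * (r / 64) / 2 : ℕ) : ℤ) + (8 * (r / 64) / 64 : ℕ)) (frameConfig 5 κ) w ∧
      PathIn triGraph (uRegB r ∩ κ) b₅ (frameIso 5 w) := by
  have hIF := uFenceB_strip_subset hr
  have c4 := castU4 hr
  have c5 := castU5 hr
  obtain ⟨b₅, t₅, hb₅, ht₅, PB5⟩ := h5
  obtain ⟨a₆, e₆, ha₆, he₆, PB6⟩ := h6
  obtain ⟨b₇, t₇, hb₇, ht₇, PB7⟩ := h7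
  obtain ⟨a₈, e₈, ha₈, he₈, PB8⟩ := h8
  obtain ⟨b₉, t₉, hb₉, ht₉, PB9⟩ := h9
  obtain ⟨b₀, t₀, hb₀, ht₀, PV⟩ := hF
  refine ⟨b₅, t₅, ?_⟩
  unfold uRegB
  simp only [Nat.cast_mul, Nat.cast_ofNat] at ht₅ he₆ ht₇ he₈ ht₀
  rw [c5] at ht₉
  obtain ⟨-, -, -, -, -, e8, e2, kt1, kt8, k64⟩ := masterUB (i := 0) hr (by norm_num)
  have F64 := flz r 64 (by norm_num)
  generalize eq64 : r / 64 = q64 at *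
  generalize et8 : 8 * q64 / 8 = t8 at *
  generalize et2 : 8 * q64 / 2 = t2 at *
  generalize ett : 8 * q64 / 64 = tt at *
  clear eq64 et8 et2 ett
  push_cast at F64
  have e8' : q64 = t8 := by exact_mod_cast e8.symm
  have e2' : t2 = 4 * q64 := by exact_mod_cast e2
  subst e8'
  subst e2'
  clear e8 e2
  -- J8 … J11
  have Q8 := PathIn.relay (L := -(22 * (q64 : ℤ))) (R := -(20 * (q64 : ℤ))) (B := -(4 * (q64 : ℤ))) (T := -(2 * (q64 : ℤ)))
    (by clear c4 c5; omega) (by clear c4 c5; omega) PB6 (by clear c4 c5; omega) (by clear c4 c5; omega)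
    (fun v hv _ _ => by rw [mem_triStrip] at hv; clear c4 c5; omega) PB5 (by clear c4 c5; omega) (by clear c4 c5; omega)
    (fun v hv _ _ => by rw [mem_triStrip] at hv; clear c4 c5; omega)
  have Q9 := PathIn.relay (L := -(9 * (q64 : ℤ))) (R := -(7 * (q64 : ℤ))) (B := -(4 * (q64 : ℤ))) (T := -(2 * (q64 : ℤ)))
    (by clear c4 c5; omega) (by clear c4 c5; omega) PB6 (by clear c4 c5; omega) (by clear c4 c5; omega)
    (fun v hv _ _ => by rw [mem_triStrip] at hv; clear c4 c5; omega) PB7 (by clear c4 c5; omega) (by clear c4 c5; omega)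
    (fun v hv _ _ => by rw [mem_triStrip] at hv; clear c4 c5; omega)
  have Q10 := PathIn.relay (L := -(9 * (q64 : ℤ))) (R := -(7 * (q64 : ℤ))) (B := -(11 * (q64 : ℤ))) (T := -(9 * (q64 : ℤ)))
    (by clear c4 c5; omega) (by clear c4 c5; omega) PB8 (by clear c4 c5; omega) (by clear c4 c5; omega)
    (fun v hv _ _ => by rw [mem_triStrip] at hv; clear c4 c5; omega) PB7 (by clear c4 c5; omega) (by clear c4 c5; omega)
    (fun v hv _ _ => by rw [mem_triStrip] at hv; clear c4 c5; omega)
  have Q11 := PathIn.relay (L := 4 * (q64 : ℤ) - tt) (R := 4 * (q64 : ℤ)) (B := -(11 * (q64 : ℤ))) (T := -(9 * (q64 : ℤ)))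
    (by clear c4 c5; omega) (by clear c4 c5; omega) PB8 (by clear c4 c5; omega) (by clear c4 c5; omega)
    (fun v hv _ _ => by rw [mem_triStrip] at hv; clear c4 c5; omega) PB9 (by clear c4 c5; omega) (by clear c4 c5; omega)
    (fun v hv _ _ => by rw [mem_triStrip] at hv; clear c4 c5; omega)
  -- J12: the connector meets the new free space (read through the reflection frame `5`)
  obtain ⟨SV, hSV, PV', TV⟩ := PV.exists_support
  have PVκ : PathIn triGraph ((frameIso 5 '' SV) ∩ κ) (frameIso 5 t₀) (frameIso 5 b₀) := by
    have h := PV'.symm.mono (show SV ⊆ SV ∩ frameConfig 5 κ from fun v hv => ⟨hv, (hSV hv).2⟩)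
    exact pathIn_of_frameConfig_five h
  obtain ⟨S₉, hS₉, PB9', T₉⟩ := PB9.exists_support
  obtain ⟨sb0, sb1⟩ := frameIso5_apply b₀
  obtain ⟨st0, st1⟩ := frameIso5_apply t₀
  obtain ⟨p, hpV, hpB⟩ := exists_mem_of_cross (L := 4 * (q64 : ℤ) - tt) (R := 4 * (q64 : ℤ))
    (B := -(8 * (q64 : ℤ)) + 1) (T := -(7 * (q64 : ℤ)) - 1) (by clear c4 c5; omega) (by clear c4 c5; omega)
    PVκ (by rw [st0, ht₀]; clear c4 c5; omega) (by rw [sb0, hb₀]; clear c4 c5; omega)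
    (fun v hv _ _ => by
      obtain ⟨w, hw, hwv⟩ := hv.1
      have h := (hSV hw).1
      rw [mem_triStrip, c4] at h
      obtain ⟨-, r1⟩ := frameIso5_apply w
      have hv1 : v 1 = -w 0 := by rw [← hwv]; exact r1
      clear c4 c5
      push_cast at h
      omega)
    PB9' (by rw [hb₉]; clear c4 c5; omega) (by rw [ht₉]; clear c4 c5; omega)
    (fun v hv _ _ => by have h := (hS₉ hv).1; rw [mem_triStrip] at h; clear c4 c5; omega)
  obtain ⟨w₆, hw₆, hw₆p⟩ : ∃ w₆ ∈ SV, frameIso 5 w₆ = p := by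
    obtain ⟨w, hw, hwp⟩ := hpV.1; exact ⟨w, hw, hwp⟩
  set Z : Site 2 := ![((8 * q64 : ℕ) : ℤ), -((4 * q64 : ℕ) : ℤ)] with hZ
  have hSVF : SV ⊆ sepInnerFence (8 * q64) Z ∩ frameConfig 5 κ := fun v hv => ⟨hIF (hSV hv).1, (hSV hv).2⟩
  have hFence : OpenVCrossThrough (sepInnerFence (8 * q64) Z) (-((4 * q64 : ℕ) : ℤ) - (tt : ℕ)) (-((4 * q64 : ℕ) : ℤ) + (tt : ℕ)) (frameConfig 5 κ) w₆ :=
    ⟨b₀, t₀, hb₀, by rw [ht₀]; ring, (TV w₆ hw₆).mono hSVF, ((TV w₆ hw₆).symm.trans (TV t₀ PV'.right_mem)).mono hSVF⟩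
  refine ⟨w₆, hb₅, by rw [ht₅]; push_cast; ring, PB5, hFence, ?_⟩
  -- the regions
  obtain ⟨zn0, zn1⟩ := frameIso5_apply Z
  have ez0 : Z 0 = ((8 * q64 : ℕ) : ℤ) := site_mk_apply_zero _ _
  have ez1 : Z 1 = -((4 * q64 : ℕ) : ℤ) := site_mk_apply_one _ _
  rw [ez1] at zn0; rw [ez0] at zn1
  push_cast at zn0 zn1
  set Rg := shellBall ((8 * q64 : ℕ) : ℤ) r (frameIso 5 Z) q64 with hRg
  have inB5 : triStrip (-(22 * (q64 : ℤ))) (-(4 * (q64 : ℤ))) (2 * q64) (16 * q64) ⊆ Rg := by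
    intro v hv; rw [mem_triStrip] at hv
    rcases le_or_gt 0 (v 1) with h | h
    · exact mem_shell_of_leftUpper (by clear c4 c5; omega) (by clear c4 c5; omega) h (by clear c4 c5; omega)
    · exact mem_shell_of_lowerLeft (by clear c4 c5; omega) (by clear c4 c5; omega) (by clear c4 c5; omega) h.le
  have inB6 : triStrip (-(22 * (q64 : ℤ))) (-(4 * (q64 : ℤ))) (15 * q64) (2 * q64) ⊆ Rg := fun v hv => by
    rw [mem_triStrip] at hv
    exact mem_shell_of_lowerLeft (by clear c4 c5; omega) (by clear c4 c5; omega) (by clear c4 c5; omega) (by clear c4 c5; omega)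
  have inB7 : triStrip (-(9 * (q64 : ℤ))) (-(11 * (q64 : ℤ))) (2 * q64) (9 * q64) ⊆ Rg := fun v hv => by
    rw [mem_triStrip] at hv
    exact mem_shell_of_lowerLeft (by clear c4 c5; omega) (by clear c4 c5; omega) (by clear c4 c5; omega) (by clear c4 c5; omega)
  have inB8 : triStrip (-(9 * (q64 : ℤ))) (-(11 * (q64 : ℤ))) (13 * q64) (2 * q64) ⊆ Rg := by
    intro v hv; rw [mem_triStrip] at hv
    rcases le_or_gt (v 0) 0 with h | h
    · exact mem_shell_of_lowerLeft (by clear c4 c5; omega) (by clear c4 c5; omega) h (by clear c4 c5; omega)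
    · exact mem_shell_of_bottom (by clear c4 c5; omega) (by clear c4 c5; omega) h.le (by clear c4 c5; omega)
  have inB9 : triStrip (4 * (q64 : ℤ) - tt) (-(11 * (q64 : ℤ))) tt (4 * q64 - 1) ⊆ Rg := by
    intro v hv; rw [mem_triStrip, c5] at hv
    rcases le_or_gt (v 1) (-(8 * (q64 : ℤ))) with h | h
    · exact mem_shell_of_bottom (by clear c4 c5; omega) (by clear c4 c5; omega) (by clear c4 c5; omega) (by clear c4 c5; omega)
    · exact mem_shell_of_near (by rw [zn0]; clear c4 c5; omega) (by rw [zn0]; clear c4 c5; omega) (by rw [zn1]; clear c4 c5; omega)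
        (by rw [zn1]; clear c4 c5; omega) (by rw [zn0, zn1]; clear c4 c5; omega) (by rw [zn0, zn1]; clear c4 c5; omega)
  have m2 : ∀ {A B : Set (Site 2)}, A ⊆ Rg → B ⊆ Rg → (A ∪ B) ∩ κ ⊆ Rg ∩ κ := fun hA hB v hv =>
    ⟨hv.1.elim (fun h => hA h) (fun h => hB h), hv.2⟩
  have K12 : PathIn triGraph (Rg ∩ κ) b₉ p := (T₉ p hpB).mono fun v hv => ⟨inB9 (hS₉ hv).1, (hS₉ hv).2⟩
  have K11 := Q11.mono (m2 inB8 inB9)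
  have K10 := Q10.mono (m2 inB8 inB7)
  have K9 := Q9.mono (m2 inB6 inB7)
  have K8 := Q8.mono (m2 inB6 inB5)
  rw [hw₆p]
  exact (((K8.symm.trans K9).trans K10.symm).trans K11).trans K12

/-- **The closed U-turn glued to the old free space of the top side.** From the horizontal (in `κ`)
crossing of the old top-side free space through `frameIso 2 u` (`frameConfig 2 κ` carries the standard
fence) and `κ ∈ uTurnB r`: a new attaching site `w` with a crossing of the standard inner free space of
`Λ_{r'}` of `frameConfig 5 κ` through it, joined to `frameIso 2 u` inside `κ` through sites of
`uRegB r`. [cite: Nolin2008, §4.2 (relocation of landing sequences), §4.3 Prop. 12 (i) (arXiv 0711.4948: Def. 8, Prop. 11)] -/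
theorem uTurnB_glue {r : ℕ} (hr : 4096 ≤ r) {κ : SiteConfig (Site 2)} {z u b t : Site 2} (hz : z ∈ sepLanding r)
    (hb : b 1 = z 1 - (r / 64 : ℕ)) (ht : t 1 = z 1 + (r / 64 : ℕ))
    (p₁ : PathIn triGraph (sepInnerFence r z ∩ frameConfig 2 κ) b u) (p₂ : PathIn triGraph (sepInnerFence r z ∩ frameConfig 2 κ) u t)
    (hB : κ ∈ uTurnB r) :
    ∃ w : Site 2, OpenVCrossThrough (sepInnerFence (8 * (r / 64)) ![((8 * (r / 64) : ℕ) : ℤ), -((8 * (r / 64) / 2 : ℕ) : ℤ)])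
        (-((8 * (r / 64) / 2 : ℕ) : ℤ) - (8 * (r / 64) / 64 : ℕ)) (-((8 * (r / 64) / 2 : ℕ) : ℤ) + (8 * (r / 64) / 64 : ℕ)) (frameConfig 5 κ) w ∧
      PathIn triGraph (uRegB r ∩ κ) (frameIso 2 u) (frameIso 5 w) := by
  obtain ⟨⟨hF, hK⟩, hG⟩ := hB
  have hK' := fun k (hk : k < 10) => (Set.mem_iInter₂.1 hK) k (Finset.mem_range.2 hk)
  obtain ⟨b₅, t₅, w, hb₅, ht₅, PB5, hFence, P2⟩ := uTurnB_glue₂ hr (hK' 5 (by norm_num)) (hK' 6 (by norm_num))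
    (hK' 7 (by norm_num)) (hK' 8 (by norm_num)) (hK' 9 (by norm_num)) hF
  have P1 := uTurnB_glue₁ hr hz hb ht p₁ p₂ hG (hK' 0 (by norm_num)) (hK' 1 (by norm_num)) (hK' 2 (by norm_num)) (hK' 3 (by norm_num))
    (hK' 4 (by norm_num)) hb₅ ht₅ PB5
  exact ⟨w, hFence, P1.trans P2⟩

end Literature.Probability.Percolation
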